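import Literature.Dynamics.Hyperbolic.HyperbolicSemiflowModel
import Mathlib.Analysis.SpecialFunctions.Pow.Real
import HarnessLib

/-!
# Growth rates of real sequences: comparison, one-step shifts and squares

Topic `Literature/Dynamics/Hyperbolic`.  Small calculus of the two growth predicates of
`HyperbolicSemiflowModel.lean` — `SeqSubExpGrowth a` (`∀ κ > 0, ∃ C, a n ≤ C e^{κ n}`: Lyapunov exponent `≤ 0`) and
`SeqExpDecay a` (`∃ κ > 0, ∃ C, a n ≤ C e^{-κ n}`: Lyapunov exponent `< 0`) — needed to TRANSPORT the hyperbolicity of an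
invariant measure between two comparable norms along a derivative cocycle (Barreira–Pesin 2023, Ch. 2: Lyapunov exponents
do not change under a tempered / bounded change of norm, and are read equally well one step later):

* `SeqSubExpGrowth.of_le`, `SeqExpDecay.of_le` — domination `a n ≤ C b n` transports both predicates;
* `SeqSubExpGrowth.of_succ_le`, `SeqExpDecay.of_succ_le` — ONE-STEP SMOOTHING `a (n+1) ≤ C b n` transports both predicates
  (the form in which the parabolic smoothing `‖w(n+1)‖_strong ≤ C ‖w(n)‖_weak` of a linearised flow is used);
* `seqSubExpGrowth_sq_iff`, `seqExpDecay_sq_iff` — for a nonnegative sequence, the predicates for `a²` and for `a` are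
  equivalent (squared `L²` norms versus norms).

All proofs are elementary manipulations of `Real.exp`.

## References

* L. Barreira, Ya. Pesin, *Introduction to Smooth Ergodic Theory*, 2nd ed., GSM 231, AMS (2023), Ch. 2 (Lyapunov exponents
  and their basic properties). [BarreiraPesin2023]
-/

noncomputable section

open Real

namespace Literature.Dynamics.Hyperbolic

variable {a b : ℕ → ℝ}

/-! ## Domination -/

/-- Sub-exponential growth is inherited by a dominated sequence: if `a n ≤ C b n` with `C ≥ 0` and `b` grows
sub-exponentially, so does `a`. [cite: BarreiraPesin2023, Ch. 2 (basic properties of Lyapunov exponents)] -/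
theorem SeqSubExpGrowth.of_le (hb : SeqSubExpGrowth b) {C : ℝ} (hC : 0 ≤ C) (h : ∀ n, a n ≤ C * b n) :
    SeqSubExpGrowth a := by
  intro κ hκ
  obtain ⟨D, hD⟩ := hb κ hκ
  refine ⟨C * D, fun n => (h n).trans ?_⟩
  rw [mul_assoc]
  exact mul_le_mul_of_nonneg_left (hD n) hC

/-- Exponential decay is inherited by a dominated sequence: if `a n ≤ C b n` with `C ≥ 0` and `b` decays exponentially,
so does `a` (same rate). [cite: BarreiraPesin2023, Ch. 2 (basic properties of Lyapunov exponents)] -/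
theorem SeqExpDecay.of_le (hb : SeqExpDecay b) {C : ℝ} (hC : 0 ≤ C) (h : ∀ n, a n ≤ C * b n) : SeqExpDecay a := by
  obtain ⟨κ, hκ, D, hD⟩ := hb
  refine ⟨κ, hκ, C * D, fun n => (h n).trans ?_⟩
  rw [mul_assoc]
  exact mul_le_mul_of_nonneg_left (hD n) hC

/-! ## One-step shifts -/

/-- ONE-STEP SMOOTHING transports sub-exponential growth: if `a (n+1) ≤ C b n` with `C ≥ 0` and `b` grows sub-exponentially,
then `a` grows sub-exponentially (the value `a 0` is absorbed in the constant). [cite: BarreiraPesin2023, Ch. 2 (basic properties of Lyapunov exponents)] -/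
theorem SeqSubExpGrowth.of_succ_le (hb : SeqSubExpGrowth b) {C : ℝ} (hC : 0 ≤ C) (h : ∀ n, a (n + 1) ≤ C * b n) :
    SeqSubExpGrowth a := by
  intro κ hκ
  obtain ⟨D, hD⟩ := hb κ hκ
  refine ⟨max (a 0) (C * max D 0), fun n => ?_⟩
  cases n with
  | zero =>
    simp only [CharP.cast_eq_zero, mul_zero, Real.exp_zero, mul_one]
    exact le_max_left _ _
  | succ n =>
    have h1 : a (n + 1) ≤ C * (max D 0 * Real.exp (κ * n)) := by
      refine (h n).trans (mul_le_mul_of_nonneg_left ?_ hC)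
      exact (hD n).trans (mul_le_mul_of_nonneg_right (le_max_left _ _) (Real.exp_pos _).le)
    have h2 : Real.exp (κ * n) ≤ Real.exp (κ * ((n + 1 : ℕ) : ℝ)) := by
      apply Real.exp_le_exp.2
      have : (n : ℝ) ≤ ((n + 1 : ℕ) : ℝ) := by exact_mod_cast Nat.le_succ n
      exact mul_le_mul_of_nonneg_left this hκ.le
    have hCD : 0 ≤ C * max D 0 := mul_nonneg hC (le_max_right _ _)
    calc a (n + 1) ≤ C * max D 0 * Real.exp (κ * n) := by rw [mul_assoc]; exact h1
      _ ≤ C * max D 0 * Real.exp (κ * ((n + 1 : ℕ) : ℝ)) := mul_le_mul_of_nonneg_left h2 hCD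
      _ ≤ max (a 0) (C * max D 0) * Real.exp (κ * ((n + 1 : ℕ) : ℝ)) :=
          mul_le_mul_of_nonneg_right (le_max_right _ _) (Real.exp_pos _).le

/-- ONE-STEP SMOOTHING transports exponential decay: if `a (n+1) ≤ C b n` with `C ≥ 0` and `b` decays exponentially, then
`a` decays exponentially with the same rate (the shift costs a factor `e^{κ}`, the value `a 0` is absorbed in the constant).
[cite: BarreiraPesin2023, Ch. 2 (basic properties of Lyapunov exponents)] -/
theorem SeqExpDecay.of_succ_le (hb : SeqExpDecay b) {C : ℝ} (hC : 0 ≤ C) (h : ∀ n, a (n + 1) ≤ C * b n) :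
    SeqExpDecay a := by
  obtain ⟨κ, hκ, D, hD⟩ := hb
  refine ⟨κ, hκ, max (a 0) (C * max D 0 * Real.exp κ), fun n => ?_⟩
  cases n with
  | zero =>
    simp only [CharP.cast_eq_zero, mul_zero, neg_zero, Real.exp_zero, mul_one]
    exact le_max_left _ _
  | succ n =>
    have h1 : a (n + 1) ≤ C * (max D 0 * Real.exp (-(κ * n))) := by
      refine (h n).trans (mul_le_mul_of_nonneg_left ?_ hC)
      exact (hD n).trans (mul_le_mul_of_nonneg_right (le_max_left _ _) (Real.exp_pos _).le)
    have h2 : Real.exp (-(κ * n)) = Real.exp κ * Real.exp (-(κ * ((n + 1 : ℕ) : ℝ))) := by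
      rw [← Real.exp_add]
      congr 1
      push_cast
      ring
    have hCD : 0 ≤ C * max D 0 := mul_nonneg hC (le_max_right _ _)
    calc a (n + 1) ≤ C * max D 0 * Real.exp (-(κ * n)) := by rw [mul_assoc]; exact h1
      _ = C * max D 0 * Real.exp κ * Real.exp (-(κ * ((n + 1 : ℕ) : ℝ))) := by rw [h2]; ring
      _ ≤ max (a 0) (C * max D 0 * Real.exp κ) * Real.exp (-(κ * ((n + 1 : ℕ) : ℝ))) :=
          mul_le_mul_of_nonneg_right (le_max_right _ _) (Real.exp_pos _).le

/-! ## Squares -/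

/-- For a nonnegative sequence, sub-exponential growth of `a²` is equivalent to sub-exponential growth of `a` (halve / double
the rate, take square roots / squares of the constants). [cite: BarreiraPesin2023, Ch. 2 (basic properties of Lyapunov exponents)] -/
theorem seqSubExpGrowth_sq_iff (ha : ∀ n, 0 ≤ a n) : SeqSubExpGrowth (fun n => a n ^ 2) ↔ SeqSubExpGrowth a := by
  constructor
  · intro h κ hκ
    obtain ⟨D, hD⟩ := h (2 * κ) (by positivity)
    refine ⟨Real.sqrt (max D 0), fun n => ?_⟩
    have h1 : a n ^ 2 ≤ max D 0 * Real.exp (2 * κ * n) :=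
      (hD n).trans (mul_le_mul_of_nonneg_right (le_max_left _ _) (Real.exp_pos _).le)
    have h2 : max D 0 * Real.exp (2 * κ * n) = (Real.sqrt (max D 0) * Real.exp (κ * n)) ^ 2 := by
      rw [mul_pow, Real.sq_sqrt (le_max_right _ _), ← Real.exp_nat_mul]
      congr 1
      push_cast
      ring_nf
    rw [h2] at h1
    have hb : 0 ≤ Real.sqrt (max D 0) * Real.exp (κ * n) := by positivity
    exact (pow_le_pow_iff_left₀ (ha n) hb two_ne_zero).1 h1
  · intro h κ hκ
    obtain ⟨D, hD⟩ := h (κ / 2) (by positivity)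
    refine ⟨max D 0 ^ 2, fun n => ?_⟩
    have h1 : a n ≤ max D 0 * Real.exp (κ / 2 * n) :=
      (hD n).trans (mul_le_mul_of_nonneg_right (le_max_left _ _) (Real.exp_pos _).le)
    have h2 : (max D 0 * Real.exp (κ / 2 * n)) ^ 2 = max D 0 ^ 2 * Real.exp (κ * n) := by
      rw [mul_pow, ← Real.exp_nat_mul]
      congr 1
      push_cast
      ring_nf
    calc a n ^ 2 ≤ (max D 0 * Real.exp (κ / 2 * n)) ^ 2 := pow_le_pow_left₀ (ha n) h1 2
      _ = max D 0 ^ 2 * Real.exp (κ * n) := h2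

/-- For a nonnegative sequence, exponential decay of `a²` is equivalent to exponential decay of `a` (halve / double the rate).
[cite: BarreiraPesin2023, Ch. 2 (basic properties of Lyapunov exponents)] -/
theorem seqExpDecay_sq_iff (ha : ∀ n, 0 ≤ a n) : SeqExpDecay (fun n => a n ^ 2) ↔ SeqExpDecay a := by
  constructor
  · rintro ⟨κ, hκ, D, hD⟩
    refine ⟨κ / 2, by positivity, Real.sqrt (max D 0), fun n => ?_⟩
    have h1 : a n ^ 2 ≤ max D 0 * Real.exp (-(κ * n)) :=
      (hD n).trans (mul_le_mul_of_nonneg_right (le_max_left _ _) (Real.exp_pos _).le)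
    have h2 : max D 0 * Real.exp (-(κ * n)) = (Real.sqrt (max D 0) * Real.exp (-(κ / 2 * n))) ^ 2 := by
      rw [mul_pow, Real.sq_sqrt (le_max_right _ _), ← Real.exp_nat_mul]
      congr 1
      push_cast
      ring_nf
    rw [h2] at h1
    have hb : 0 ≤ Real.sqrt (max D 0) * Real.exp (-(κ / 2 * n)) := by positivity
    exact (pow_le_pow_iff_left₀ (ha n) hb two_ne_zero).1 h1
  · rintro ⟨κ, hκ, D, hD⟩
    refine ⟨2 * κ, by positivity, max D 0 ^ 2, fun n => ?_⟩
    have h1 : a n ≤ max D 0 * Real.exp (-(κ * n)) :=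
      (hD n).trans (mul_le_mul_of_nonneg_right (le_max_left _ _) (Real.exp_pos _).le)
    have h2 : (max D 0 * Real.exp (-(κ * n))) ^ 2 = max D 0 ^ 2 * Real.exp (-(2 * κ * n)) := by
      rw [mul_pow, ← Real.exp_nat_mul]
      congr 1
      push_cast
      ring_nf
    calc a n ^ 2 ≤ (max D 0 * Real.exp (-(κ * n))) ^ 2 := pow_le_pow_left₀ (ha n) h1 2
      _ = max D 0 ^ 2 * Real.exp (-(2 * κ * n)) := h2

end Literature.Dynamics.Hyperbolic

end
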